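import Summits.AtomisticToContinuum.HydrodynamicLimit.Theorems.CollisionIsometryCLTMacroClosureRuelleMaster
import HarnessLib

/-!
# Ruelle's super-multiplicativity of the inner-cube box free volume

Support file (`--supports stmt-AtomisticToContinuum-14870`) of the line `IdeatorTwoGen1Sketch` for
the crux `MacroClosure`, wave 4 (existence of the thermodynamic limit of the hard-sphere free
energy): the registered stub `tl_super`.

**The box free volume.** For `m` labelled points of `ℝ³`, a side `S` and an exclusion `e`, the
*inner-cube box free volume* is the Lebesgue measure of
`{w : Fin m → V3 | (∀ i l, |w i l| ≤ S/2) ∧ ∀ i ≠ j, e ≤ ‖w i - w j‖}` (points of the closed cube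
`[-S/2, S/2]³`, pairwise at Euclidean distance `≥ e`). At `S = 1 - t`, `e = t` the cube sits
inside the unit cube with a built-in half-corridor `t/2`.

**Super-multiplicativity (this file).** Gluing `k³` copies of the `m`-particle box (side `1 - t`,
exclusion `t`), each scaled by `1/k` into one of the `k³` grid cells
`C j = {x | ∀ l, |reprSym (x - j/k) l| ≤ s/2}`, `s = (1 - t)/k`, of the unit torus `𝕋³`, produces
configurations of `N = k³ m` points of the big inner cube `{x | ∀ l, |reprSym (x - c₀) l| ≤ (1 - t/k)/2}`,
`c₀ = ((k-1)/(2k), (k-1)/(2k), (k-1)/(2k))`, that are pairwise `t/k`-separated in the minimal-image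
distance (the cells are `t/k` apart, `fv_cube_separation`). Counting the labellings
(`fv_cells_product_lower`, multinomial weight `N!/(m!)^{k³}`) and reading each cell factor in the
Euclidean chart (`FvCubeToTorus.volume_constraint_le`, Lebesgue scaling
`FvCubeToTorus.volume_smul_set`) gives

`N!/(m!)^{k³} · k^{-3N} · B(m, 1 - t, t)^{k³} ≤ Haar {q : Fin N → 𝕋³ | big inner cube, pairwise ≥ t/k}`.

Reference: D. Ruelle, *Statistical Mechanics: Rigorous Results* (1969), §3.4 (free boundary
conditions with corridors; the architecture is that of `RuelleMaster.master`).
-/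

noncomputable section

open MeasureTheory Filter Set Topology
open scoped ENNReal Pointwise

namespace Summit.AtomisticToContinuum.HydrodynamicLimit.Theorems.MacroClosureLine

open Literature.MathematicalPhysics.KineticTheory Literature.Analysis.FluidPDE
open Literature.Analysis.FunctionSpaces

namespace Barycentric

namespace TlSuper

/-! ### An elementary estimate on the grid -/

/-- A grid abscissa `a/k`, `a < k`, is within `(k-1)/(2k)` of the centre `(k-1)/(2k)` of
`[0, (k-1)/k]`. [folklore] -/
theorem abs_grid_sub_centre_le {k : ℕ} (hk : (0 : ℝ) < k) (a : Fin k) :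
    |((a : ℕ) : ℝ) / k - ((k : ℝ) - 1) / (2 * k)| ≤ ((k : ℝ) - 1) / (2 * k) := by
  have ha0 : (0 : ℝ) ≤ ((a : ℕ) : ℝ) / k := by positivity
  have ha1 : ((a : ℕ) : ℝ) ≤ (k : ℝ) - 1 := by
    have h : (a : ℕ) + 1 ≤ k := a.isLt
    have h' : (((a : ℕ) + 1 : ℕ) : ℝ) ≤ k := by exact_mod_cast h
    push_cast at h'
    linarith
  have ha2 : ((a : ℕ) : ℝ) / k ≤ ((k : ℝ) - 1) / k := div_le_div_of_nonneg_right ha1 hk.le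
  have hcen : ((k : ℝ) - 1) / k = 2 * (((k : ℝ) - 1) / (2 * k)) := by
    field_simp
  rw [abs_le]
  constructor <;> linarith

/-! ### Scaling the box into a cell -/

/-- The homothety of ratio `1/k` maps the `m`-particle box of side `1 - t` and exclusion `t` into
the box of side `(1 - t)/k` and exclusion `t/k`. [folklore] -/
theorem smul_subset (m : ℕ) {k : ℝ} (hk : 0 < k) (t : ℝ) :
    (1 / k) • {w : Fin m → V3 | (∀ i l, |w i l| ≤ (1 - t) / 2) ∧ ∀ i j, i ≠ j → t ≤ ‖w i - w j‖} ⊆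
      {v : Fin m → V3 | (∀ i l, |v i l| ≤ (1 - t) / k / 2) ∧
        ∀ i j, i ≠ j → t / k ≤ ‖v i - v j‖} := by
  intro v hv
  obtain ⟨w, hw, rfl⟩ := Set.mem_smul_set.1 hv
  have hk' : 0 < 1 / k := by positivity
  refine ⟨fun i l => ?_, fun i j hij => ?_⟩
  · rw [Pi.smul_apply, PiLp.smul_apply, smul_eq_mul, abs_mul, abs_of_pos hk']
    have h := hw.1 i l
    calc 1 / k * |w i l| ≤ 1 / k * ((1 - t) / 2) := by gcongr
      _ = (1 - t) / k / 2 := by ring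
  · rw [Pi.smul_apply, Pi.smul_apply, ← smul_sub, norm_smul, Real.norm_of_nonneg hk'.le]
    have h := hw.2 i j hij
    calc t / k = 1 / k * t := by ring
      _ ≤ 1 / k * ‖w i - w j‖ := by gcongr

/-- **The cell factor.** The Haar volume of `m` points of the grid cell of side `(1 - t)/k`
centred at `c`, pairwise `t/k`-separated on the torus, is at least `k^{-3m}` times the box free
volume `B(m, 1 - t, t)` (Lebesgue scaling and the chart `FvCubeToTorus.volume_constraint_le`).
[cite: Ruelle1969, §3.4] -/
theorem cell_factor (m : ℕ) (c : T3) {k t : ℝ} (hk : 0 < k) (hs : (1 - t) / k < 1 / 2) :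
    (1 / k) ^ (3 * m) * (volume {w : Fin m → V3 | (∀ i l, |w i l| ≤ (1 - t) / 2) ∧
        ∀ i j, i ≠ j → t ≤ ‖w i - w j‖}).toReal ≤
      (volume {x : Fin m → T3 | (∀ i l, |Torus.reprSym (x i - c) l| ≤ (1 - t) / k / 2) ∧
        ∀ i i', i ≠ i' → t / k ≤ Torus.euclidDist (x i) (x i')}).toReal := by
  have key : ENNReal.ofReal ((1 / k) ^ (3 * m)) * volume {w : Fin m → V3 |
      (∀ i l, |w i l| ≤ (1 - t) / 2) ∧ ∀ i j, i ≠ j → t ≤ ‖w i - w j‖} ≤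
      volume {x : Fin m → T3 | (∀ i l, |Torus.reprSym (x i - c) l| ≤ (1 - t) / k / 2) ∧
        ∀ i i', i ≠ i' → t / k ≤ Torus.euclidDist (x i) (x i')} :=
    calc ENNReal.ofReal ((1 / k) ^ (3 * m)) * volume {w : Fin m → V3 |
          (∀ i l, |w i l| ≤ (1 - t) / 2) ∧ ∀ i j, i ≠ j → t ≤ ‖w i - w j‖}
        = volume ((1 / k) • {w : Fin m → V3 |
            (∀ i l, |w i l| ≤ (1 - t) / 2) ∧ ∀ i j, i ≠ j → t ≤ ‖w i - w j‖}) :=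
          (FvCubeToTorus.volume_smul_set m (by positivity) _).symm
      _ ≤ volume {v : Fin m → V3 | (∀ i l, |v i l| ≤ (1 - t) / k / 2) ∧
            ∀ i j, i ≠ j → t / k ≤ ‖v i - v j‖} := measure_mono (smul_subset m hk t)
      _ ≤ _ := FvCubeToTorus.volume_constraint_le m c (t / k) hs
  have hfin : volume {x : Fin m → T3 | (∀ i l, |Torus.reprSym (x i - c) l| ≤ (1 - t) / k / 2) ∧
      ∀ i i', i ≠ i' → t / k ≤ Torus.euclidDist (x i) (x i')} ≠ ∞ := measure_ne_top _ _
  have h := ENNReal.toReal_mono hfin key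
  rwa [ENNReal.toReal_mul, ENNReal.toReal_ofReal (by positivity)] at h

/-! ### The cells lie in the big inner cube -/

/-- A point of the grid cell of side `(1 - t)/k` around `j/k` lies in the big inner cube of side
`1 - t/k` centred at `c₀ = ((k-1)/(2k))_l`: coordinatewise on the circle,
`‖x l - c₀ l‖ ≤ ‖x l - j l/k‖ + ‖j l/k - (k-1)/(2k)‖ ≤ (1-t)/(2k) + (k-1)/(2k)`. [folklore] -/
theorem abs_reprSym_sub_centre_le {k : ℕ} (hk : (0 : ℝ) < k) (t : ℝ) (j : Fin 3 → Fin k) (x : T3)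
    (hx : ∀ l, |Torus.reprSym (x - fun l => (((((j l : ℕ) : ℝ) / k : ℝ)) : UnitAddCircle)) l| ≤
      (1 - t) / k / 2) (l : Fin 3) :
    |Torus.reprSym (x - fun _ => (((((k : ℝ) - 1) / (2 * k) : ℝ)) : UnitAddCircle)) l| ≤
      (1 - t / k) / 2 := by
  have h1 := hx l
  rw [Torus.abs_reprSym_apply, Pi.sub_apply] at h1
  rw [Torus.abs_reprSym_apply, Pi.sub_apply]
  set a : UnitAddCircle := (((((j l : ℕ) : ℝ) / k : ℝ)) : UnitAddCircle) with ha
  set b : UnitAddCircle := (((((k : ℝ) - 1) / (2 * k) : ℝ)) : UnitAddCircle) with hb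
  have h2 : ‖a - b‖ ≤ ((k : ℝ) - 1) / (2 * k) := by
    rw [ha, hb, ← AddCircle.coe_sub]
    refine le_trans ?_ (abs_grid_sub_centre_le hk (j l))
    -- the quotient norm of `ℝ/ℤ` is `|r - round r| ≤ |r|` (`round_le`)
    rw [UnitAddCircle.norm_eq]
    simpa using round_le ((((j l : ℕ) : ℝ)) / k - ((k : ℝ) - 1) / (2 * k)) 0
  calc ‖x l - b‖ = ‖(x l - a) + (a - b)‖ := by congr 1; abel
    _ ≤ ‖x l - a‖ + ‖a - b‖ := norm_add_le _ _
    _ ≤ (1 - t) / k / 2 + ((k : ℝ) - 1) / (2 * k) := add_le_add h1 h2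
    _ = (1 - t / k) / 2 := by
        field_simp
        ring

end TlSuper

open TlSuper in
/-- **Registered stub `tl_super`: Ruelle's super-multiplicativity of the inner-cube box free
volume.** Gluing `k³` copies of the `m`-particle Euclidean box (side `1 - t`, exclusion `t`),
scaled by `1/k` into the grid cells of the unit torus (corridor `t/k`), lands in the set of
`k³ m` points of the big inner cube (side `1 - t/k`) that are pairwise `t/k`-separated; with the
multinomial count of the labellings,
`(k³m)!/(m!)^{k³} · k^{-3k³m} · B^{k³} ≤ Haar(big inner cube configurations)`.
[cite: Ruelle1969, §3.4] -/
theorem tl_super : ∀ (k m : ℕ) (t : ℝ), 2 ≤ k → 0 < t → t < 1 → ((k ^ 3 * m).factorial : ℝ) / ((m.factorial : ℝ) ^ (k ^ 3)) / (k : ℝ) ^ (3 * (k ^ 3 * m)) * ((volume {w : Fin m → V3 | (∀ i l, |w i l| ≤ (1 - t) / 2) ∧ ∀ i j, i ≠ j → t ≤ ‖w i - w j‖}).toReal) ^ (k ^ 3) ≤ (volume {q : Fin (k ^ 3 * m) → T3 | (∀ i l, |Torus.reprSym (q i - fun _ => (((((k : ℝ) - 1) / (2 * k) : ℝ)) : UnitAddCircle))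 l| ≤ (1 - t / k) / 2) ∧ ∀ i j, i ≠ j → t / k ≤ Torus.euclidDist (q i) (q j)}).toReal := by
  intro k m t hk ht ht1
  -- basic quantities: exclusion `E = t/k`, cell side `s = (1 - t)/k`
  have hk0 : (0 : ℝ) < k := by exact_mod_cast (lt_of_lt_of_le (by norm_num) hk)
  have hk2 : (2 : ℝ) ≤ k := by exact_mod_cast hk
  have hks : (1 : ℝ) / k ≤ 1 / 2 := one_div_le_one_div_of_le (by norm_num) hk2
  have hE0 : 0 < t / k := div_pos ht hk0
  have hs1 : (1 - t) / k < 1 / (k : ℝ) := div_lt_div_of_pos_right (by linarith) hk0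
  have hs12 : (1 - t) / k < 1 / 2 := lt_of_lt_of_le hs1 hks
  have hEk : 2 * (t / k / 2) < 1 / (k : ℝ) := by
    have := div_lt_div_of_pos_right ht1 hk0
    linarith
  have hsE : (1 - t) / k / 2 = (1 / (k : ℝ) - 2 * (t / k / 2)) / 2 := by
    field_simp
  -- the box free volume
  set B : ℝ := (volume {w : Fin m → V3 | (∀ i l, |w i l| ≤ (1 - t) / 2) ∧
    ∀ i j, i ≠ j → t ≤ ‖w i - w j‖}).toReal with hB
  have hB0 : 0 ≤ B := ENNReal.toReal_nonneg
  -- the cells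
  set g : (Fin 3 → Fin k) → T3 := fun j l => (((((j l : ℕ) : ℝ) / k : ℝ)) : UnitAddCircle) with hg
  set C : (Fin 3 → Fin k) → Set T3 :=
    fun j => {x : T3 | ∀ l, |Torus.reprSym (x - g j) l| ≤ (1 - t) / k / 2} with hC
  -- separation of the cells
  have hsep : ∀ j ∈ (Finset.univ : Finset (Fin 3 → Fin k)), ∀ j' ∈ (Finset.univ : Finset _),
      j ≠ j' → ∀ x ∈ C j, ∀ y ∈ C j', t / k ≤ Torus.euclidDist x y := by
    intro j _ j' _ hjj x hx y hy
    have hx' : ∀ l, |Torus.reprSym (x - fun l => (((((j l : ℕ) : ℝ) / k : ℝ)) : UnitAddCircle)) l|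
        ≤ (1 / (k : ℝ) - 2 * (t / k / 2)) / 2 := by
      intro l; have := hx l; rwa [hsE] at this
    have hy' : ∀ l, |Torus.reprSym (y - fun l => (((((j' l : ℕ) : ℝ) / k : ℝ)) : UnitAddCircle)) l|
        ≤ (1 / (k : ℝ) - 2 * (t / k / 2)) / 2 := by
      intro l; have := hy l; rwa [hsE] at this
    have := fv_cube_separation k j j' (t / k / 2) x y hjj (by positivity) hEk hx' hy'
    linarith
  -- the product lower bound over the cells
  have hcardκ : Fintype.card (Fin 3 → Fin k) = k ^ 3 := by
    rw [Fintype.card_fun, Fintype.card_fin, Fintype.card_fin]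
  have hsum : ∑ j ∈ (Finset.univ : Finset (Fin 3 → Fin k)), (fun _ : Fin 3 → Fin k => m) j =
      Fintype.card (Fin (k ^ 3 * m)) := by
    rw [Finset.sum_const, Finset.card_univ, hcardκ, Fintype.card_fin, smul_eq_mul]
  have hcells : ((Fintype.card (Fin (k ^ 3 * m))).factorial : ℝ) /
      (∏ _j ∈ (Finset.univ : Finset (Fin 3 → Fin k)), (m.factorial : ℝ)) *
        ∏ j ∈ (Finset.univ : Finset (Fin 3 → Fin k)), (volume {x : Fin m → T3 | (∀ i, x i ∈ C j) ∧
          ∀ i i', i ≠ i' → t / k ≤ Torus.euclidDist (x i) (x i')}).toReal ≤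
      (volume {q : Fin (k ^ 3 * m) → T3 | (∀ i, ∃ j ∈ (Finset.univ : Finset (Fin 3 → Fin k)),
        q i ∈ C j) ∧ ∀ i i', i ≠ i' → t / k ≤ Torus.euclidDist (q i) (q i')}).toReal :=
    fv_cells_product_lower (Fin (k ^ 3 * m)) (Fin 3 → Fin k) Finset.univ C (fun _ => m) (t / k)
      hE0 (fun j _ => RuelleMaster.measurableSet_cell (g j) ((1 - t) / k)) hsep hsum
  -- the glued configurations lie in the big inner cube
  have hincl : (volume {q : Fin (k ^ 3 * m) → T3 | (∀ i, ∃ j ∈ (Finset.univ : Finset (Fin 3 → Fin k)),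
      q i ∈ C j) ∧ ∀ i i', i ≠ i' → t / k ≤ Torus.euclidDist (q i) (q i')}).toReal ≤
      (volume {q : Fin (k ^ 3 * m) → T3 | (∀ i l, |Torus.reprSym (q i - fun _ =>
        (((((k : ℝ) - 1) / (2 * k) : ℝ)) : UnitAddCircle)) l| ≤ (1 - t / k) / 2) ∧
          ∀ i j, i ≠ j → t / k ≤ Torus.euclidDist (q i) (q j)}).toReal := by
    refine ENNReal.toReal_mono (measure_ne_top _ _) (measure_mono ?_)
    rintro q ⟨hq1, hq2⟩
    refine ⟨fun i l => ?_, hq2⟩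
    obtain ⟨j, -, hij⟩ := hq1 i
    exact abs_reprSym_sub_centre_le hk0 t j (q i) hij l
  -- each cell factor dominates the rescaled box free volume
  have hW : ∀ j : Fin 3 → Fin k, (1 / (k : ℝ)) ^ (3 * m) * B ≤
      (volume {x : Fin m → T3 | (∀ i, x i ∈ C j) ∧
        ∀ i i', i ≠ i' → t / k ≤ Torus.euclidDist (x i) (x i')}).toReal := fun j =>
    cell_factor m (g j) hk0 hs12
  have hprodW : ∏ j ∈ (Finset.univ : Finset (Fin 3 → Fin k)), (1 / (k : ℝ)) ^ (3 * m) * B ≤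
      ∏ j ∈ (Finset.univ : Finset (Fin 3 → Fin k)), (volume {x : Fin m → T3 | (∀ i, x i ∈ C j) ∧
        ∀ i i', i ≠ i' → t / k ≤ Torus.euclidDist (x i) (x i')}).toReal :=
    Finset.prod_le_prod (fun j _ => by positivity) fun j _ => hW j
  -- constants as products over the cells
  have hprod_const : ∏ _j ∈ (Finset.univ : Finset (Fin 3 → Fin k)), (1 / (k : ℝ)) ^ (3 * m) * B =
      ((1 / (k : ℝ)) ^ (3 * m) * B) ^ (k ^ 3) := by
    rw [Finset.prod_const, Finset.card_univ, hcardκ]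
  have hfact_const : ∏ _j ∈ (Finset.univ : Finset (Fin 3 → Fin k)), (m.factorial : ℝ) =
      (m.factorial : ℝ) ^ (k ^ 3) := by
    rw [Finset.prod_const, Finset.card_univ, hcardκ]
  have hLHS : ((k ^ 3 * m).factorial : ℝ) / ((m.factorial : ℝ) ^ (k ^ 3)) / (k : ℝ) ^ (3 * (k ^ 3 * m)) *
      B ^ (k ^ 3) = ((k ^ 3 * m).factorial : ℝ) / ((m.factorial : ℝ) ^ (k ^ 3)) *
        ((1 / (k : ℝ)) ^ (3 * m) * B) ^ (k ^ 3) := by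
    rw [mul_pow, ← pow_mul, show 3 * m * k ^ 3 = 3 * (k ^ 3 * m) by ring, one_div, inv_pow]
    ring
  have hmult : 0 ≤ ((k ^ 3 * m).factorial : ℝ) /
      ∏ _j ∈ (Finset.univ : Finset (Fin 3 → Fin k)), (m.factorial : ℝ) := by positivity
  -- assemble
  calc ((k ^ 3 * m).factorial : ℝ) / ((m.factorial : ℝ) ^ (k ^ 3)) / (k : ℝ) ^ (3 * (k ^ 3 * m)) *
        B ^ (k ^ 3)
      = ((k ^ 3 * m).factorial : ℝ) / ((m.factorial : ℝ) ^ (k ^ 3)) *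
          ((1 / (k : ℝ)) ^ (3 * m) * B) ^ (k ^ 3) := hLHS
    _ = ((k ^ 3 * m).factorial : ℝ) / (∏ _j ∈ (Finset.univ : Finset (Fin 3 → Fin k)),
          (m.factorial : ℝ)) *
          ∏ _j ∈ (Finset.univ : Finset (Fin 3 → Fin k)), (1 / (k : ℝ)) ^ (3 * m) * B := by
        rw [hfact_const, hprod_const]
    _ ≤ ((k ^ 3 * m).factorial : ℝ) / (∏ _j ∈ (Finset.univ : Finset (Fin 3 → Fin k)),
          (m.factorial : ℝ)) *
          ∏ j ∈ (Finset.univ : Finset (Fin 3 → Fin k)), (volume {x : Fin m → T3 | (∀ i, x i ∈ C j) ∧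
            ∀ i i', i ≠ i' → t / k ≤ Torus.euclidDist (x i) (x i')}).toReal :=
        mul_le_mul_of_nonneg_left hprodW hmult
    _ = ((Fintype.card (Fin (k ^ 3 * m))).factorial : ℝ) /
          (∏ _j ∈ (Finset.univ : Finset (Fin 3 → Fin k)), (m.factorial : ℝ)) *
          ∏ j ∈ (Finset.univ : Finset (Fin 3 → Fin k)), (volume {x : Fin m → T3 | (∀ i, x i ∈ C j) ∧
            ∀ i i', i ≠ i' → t / k ≤ Torus.euclidDist (x i) (x i')}).toReal := by
        rw [Fintype.card_fin]
    _ ≤ _ := hcells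
    _ ≤ _ := hincl

end Barycentric

end Summit.AtomisticToContinuum.HydrodynamicLimit.Theorems.MacroClosureLine

end
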